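/-
Copyright (c) 2026 the pub-hodgecm-mathlib formalisation cell (harness21).  Prover seat hodgecm-mathlib-K2E3-p34 (g2), Track B «K2-LIT» ∕ h413 = `stmt-HodgeConjecture-24833`,
line `K2_E3_EllipticInputs`, unit U4 «Keys», socket :182 `sig_K2E3KeysThmTwoContractingRamifiedCharOnePosDepth`, programme A_pos^{<}: brick (N-T) «TRANSPORT OF A
CHART-(I) DEPTH WITNESS FOR THE SWAPPED GROUP `J_{e^w}` TO THE UPPER SHELLS OF THE BIG CELL» (memo `K2/K2E3-p34/g2/CENSUS-Apos-lt-shells.md` §3; K2E3-p37 (g2)'s R0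
DESIGN 2026-09-04T22:33:32Z chart (N)); dealer K2E3-plan (g5).  REPORT-FIRST 2026-09-04.
-/
import Summits.HodgeConjecture.HodgeConjecture.Theorems.K2E3LowerUnipotentDeepCellTwoDepth    -- ★ (ii)^{<} (this seat): brings ★ p861613 `exists_borel_mul_weylLongU_mul_upper` and ★ D174's letters `e Jg hJg`
import HarnessLib

/-!
# K2 ∕ E3 «EllipticInputs», unit U4 «Keys» — (U4f-χ₁-ram-one-pos), programme A_pos^{<} brick (N-T): THE UPPER SHELLS OF THE BIG CELL — TRANSPORT OF A DEPTH WITNESS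
# FOR THE SWAPPED TWO-DEPTH GROUP «`j″ = ū(x∕z,1∕z)⁻¹·u″·ū(x∕z,1∕z) ∈ J_{e^w}`, `(j″)₀₀ = (1+c)(1+ε)` ⟹ `b₀ := w·(j″)⁻¹·w ∈ J_e`, `ū(x,z)·b₀·ū(x,z)⁻¹ ∈ N`,
# `(b₀)₀₀ = σ(1+c)·σ(1+ε)`»   [Roche1998 §4; Casselman1995 Prop. 1.3.1, §6.3; BruhatTits1972 (4.4.4), (6.4.9); Rogawski1990 §1.9–§1.10]

Cell hodgecm-mathlib, Track B «K2-LIT», crux item H413 = stmt-HodgeConjecture-24833 (route `HCCMUnconditional`, no route verbs); target BY NAME the OPEN tier-0 leaf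
`…K2E3EllipticInputs.U4Keys.sig_K2E3KeysThmTwoContractingRamifiedCharOnePosDepth` (U4Keys :182), regime A_pos^{<}.  Author K2E3-p34 (g2).  `--supports stmt-HodgeConjecture-24833
--as helper`; THEOREMS ONLY (no `def` ∕ `instance` ∕ `notation` ∕ named fact ∕ `sorry`); MODEL level (`U(σ, Φ₃)(K)`, `Valued K ℤᵐ⁰`, an isometric involution `σ`, a uniformiser `ϖ`);
letters of ★ p861613 ∕ ★ p861919 (`ū(x,z) = !![1,0,0; −σx,1,0; z,x,1]`) and of ★ D174 (`e`, `Jg`, `hJg`), plus the SWAPPED test letter `hJgw : ∀ k, k ∈ Jgw ↔ ∀ i j, |k i j| ≤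
|ϖ| ^ e (rev i) (rev j)` (the group `J_{e^w} = w J_e w`).  NOT THE PAYER of :182.

THE POINT.  The cell family of the engine ★ p861573 for the two-depth group `J_e` (memo §2, K2E3-p37 (g2)'s R0 22:33Z): a lower unipotent `n̄ = ū(x, z)` is in `J_e`, or on the
DEEP/SHARP big cell `P·w·J_e` (★ `K2E3LowerUnipotentDeepCellTwoDepth`: `|x∕z| ≤ |ϖ|^{e 0 1}`, `|z| ≥ |ϖ|^{-e 0 2}`), or on a LOWER shell (`|z| ≤ 1`: chart (I), witnesses ★
`K2E3TwoDepthDepthWitness` families X∕Z, K2E3-p37), or on an UPPER shell: `|z| ≥ 1` but `u(x∕z, 1∕z) ∉ J_e`.  By ★ p861613, `ū(x,z) = p·w·u(a,c′)` with `(a, c′) = (x∕z, 1∕z)`,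
`p ∈ B`, and `u(a,c′) = w·ū(a,c′)·w` with `ū(a,c′) ∈ N̄` INTEGRAL — a chart-(I) point for the SWAPPED exponents `e^w i j := e (rev i) (rev j)` (`(w g w)ᵢⱼ = g_{rev i, rev j}`).  THIS
FILE is the transport: from a chart-(I) witness for `ū′ := ū(a, c′)` in `J_{e^w}` — `u″ ∈ N`, `j″ := ū′⁻¹ u″ ū′ ∈ J_{e^w}`, `(j″)₀₀ = (1+c)(1+ε)` (the conclusion shape of ★
`K2E3TwoDepthDepthWitness.exists_familyX_witness_twoDepth` ∕ `…Z…` VERBATIM, read for `(Jgw, hJgw)`) — to the engine's witness at the representative `r = ū(x,z)`: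
  `b₀ := w · (j″)⁻¹ · w ∈ J_e` (the test read backwards: `(w g⁻¹ w)ᵢⱼ = σ g_{j i}`, anti-transpose symmetry `e (rev j) (rev i) = e i j`),
  `ū(x,z) · b₀ · ū(x,z)⁻¹ = p · u″⁻¹ · p⁻¹ ∈ N` (`B` normalises `N`; so `τ = χδ^{½}` is `1` on it), and `(b₀)₀₀ = ((j″)⁻¹)₂₂ = σ((j″)₀₀) = σ(1+c)·σ(1+ε)`
— so `θ(b₀) = χ₁(σ(1+c))·χ₁(1+σε) = χ₁(1 + σc) ≠ 1 = τ(ū b₀ ū⁻¹)` as soon as `χ₁(1 + σc) ≠ 1` (family X: feed `c := σc₁`; family Z: `σc = c`) and `|ε| ≤ |ϖ|^{cond}`.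
* §1 `weylConj_inv_mem_of_forall` (`w g⁻¹ w ∈ Jg` from the swapped test on `g`), `weylConj_inv_apply_zero_zero` (`(w g⁻¹ w)₀₀ = σ g₀₀`), `conj_mem_unipotentU_of_mem_borelU`.
* §2 **`exists_upperShell_witness`** (coordinates: `n̄ = ū(x,z)`, `z ≠ 0`, `ū′ = ū(x∕z, 1∕z)`, a chart-(I) witness `u″` for `ū′` in `Jgw` ⟹ `∃ b₀ ∈ Jg, n̄ b₀ n̄⁻¹ ∈ N ∧ (b₀)₀₀ = σ(1+c)·σ(1+ε)`)
  and **`exists_upperShell_witness_of_exists`** (the same consuming the `∃ u″, …` package of ★ `K2E3TwoDepthDepthWitness` as ONE hypothesis).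
HONEST LABEL: HC_CM is proved only modulo the 7 printed citations (2 remaining named inputs: hLiu418 = stmt-HodgeConjecture-24832, h413 = stmt-HodgeConjecture-24833)
until rung 0 closes; count-neutral — this file pays no socket and closes nothing; no printed citation is discharged.

## References
* [Roche1998] A. Roche, *Types and Hecke algebras for principal series representations of split reductive p-adic groups*, Ann. Sci. ÉNS (4) 31 (1998), §4 (relevance of `P g J`).
* [Casselman1995] W. Casselman, *Introduction to the theory of admissible representations of `p`-adic reductive groups* (1995), Prop. 1.3.1, §6.3.
* [BruhatTits1972] F. Bruhat, J. Tits, *Groupes réductifs sur un corps local I*, Publ. Math. IHÉS 41 (1972), (4.4.4), (6.4.9).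
* [Rogawski1990] J. D. Rogawski, *Automorphic Representations of Unitary Groups in Three Variables*, Ann. of Math. Stud. 123 (1990), §1.9–§1.10 pp. 8–9.
-/

set_option autoImplicit false
-- the mandated namespace repeats the single-problem summit's segment (`HodgeConjecture.HodgeConjecture`)
set_option linter.dupNamespace false

noncomputable section

open Matrix Literature.NumberTheory.Automorphic Literature.NumberTheory.Automorphic.UnitaryGroup
open scoped Matrix MatrixGroups WithZero

namespace Summit.HodgeConjecture.HodgeConjecture.Cruxes.H413.K2E3TwoDepthUpperShellTransport

open Summit.HodgeConjecture.HodgeConjecture.Cruxes.H413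

variable {K : Type*} [Field K] [Valued K ℤᵐ⁰]
  (σ : K →+* K) {ϖ : K} {J : Matrix (Fin 3) (Fin 3) K} (hJ : J = (StdForm.antidiagonal 3).over K)
  (hσ : ∀ a, σ (σ a) = a) (hvσ : ∀ a, Valued.v (σ a) = Valued.v a)
  (e : Fin 3 → Fin 3 → ℕ) (Jg Jgw : Subgroup ↥(unitaryGroupOfForm σ J))
  (hJg : ∀ k : ↥(unitaryGroupOfForm σ J), k ∈ Jg ↔ ∀ i j, Valued.v (((k : GL (Fin 3) K) : Matrix (Fin 3) (Fin 3) K) i j) ≤ Valued.v ϖ ^ e i j)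
  (hJgw : ∀ k : ↥(unitaryGroupOfForm σ J), k ∈ Jgw ↔ ∀ i j, Valued.v (((k : GL (Fin 3) K) : Matrix (Fin 3) (Fin 3) K) i j) ≤ Valued.v ϖ ^ e (Fin.rev i) (Fin.rev j))

/-! ## §1 `w g⁻¹ w`: the swapped test read backwards, and its `(0,0)` entry -/

include hJ hvσ hJg hJgw in
/-- **`g ∈ J_{e^w} ⟹ w g⁻¹ w ∈ J_e`** under the anti-transpose symmetry `e (rev j) (rev i) = e i j`: `(w g⁻¹ w)ᵢⱼ = (g⁻¹)_{rev i, rev j} = σ(g_{j, i})` (★ `coe_inv_apply_eq`,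
★ `coe_weylLongU_mul_mul_weylLongU_apply'`), and `|g_{j i}| ≤ |ϖ|^{e (rev j) (rev i)} = |ϖ|^{e i j}`. [cite: BruhatTits1972, (6.4.9)] [cite: Rogawski1990, §1.10 p. 9] -/
theorem weylConj_inv_mem_of_mem (hsym : ∀ i j, e (Fin.rev j) (Fin.rev i) = e i j) {g : ↥(unitaryGroupOfForm σ J)} (hg : g ∈ Jgw) :
    weylLongU σ hJ * g⁻¹ * weylLongU σ hJ ∈ Jg := by
  rw [hJg]
  intro i j
  rw [coe_weylLongU_mul_mul_weylLongU_apply', coe_inv_apply_eq σ hJ g, Fin.rev_rev, Fin.rev_rev, hvσ, ← hsym i j]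
  exact ((hJgw g).1 hg) j i

omit [Valued K ℤᵐ⁰] in
include hJ in
/-- `(w g⁻¹ w)₀₀ = σ(g₀₀)` (`(g⁻¹)₂₂ = σ g₀₀`). [cite: Rogawski1990, §1.9 p. 8] -/
theorem weylConj_inv_apply_zero_zero (g : ↥(unitaryGroupOfForm σ J)) :
    (((weylLongU σ hJ * g⁻¹ * weylLongU σ hJ : ↥(unitaryGroupOfForm σ J)) : GL (Fin 3) K) : Matrix (Fin 3) (Fin 3) K) 0 0 =
      σ (((g : GL (Fin 3) K) : Matrix (Fin 3) (Fin 3) K) 0 0) := by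
  rw [coe_weylLongU_mul_mul_weylLongU_apply', coe_inv_apply_eq σ hJ g]
  rfl

omit [Valued K ℤᵐ⁰] in
/-- `p u p⁻¹ ∈ N` for `p ∈ B`, `u ∈ N` (★ `borelU_le_normalizer`). [cite: Rogawski1990, §1.10 p. 9] -/
theorem conj_mem_unipotentU_of_mem_borelU {p u : ↥(unitaryGroupOfForm σ J)} (hp : p ∈ borelU σ J) (hu : u ∈ unipotentU σ J) :
    p * u * p⁻¹ ∈ unipotentU σ J :=
  (Subgroup.mem_normalizer_iff.1 (borelU_le_normalizer σ J hp) u).1 hu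

/-! ## §2 The transport -/

omit [Valued K ℤᵐ⁰] in
include hJ in
/-- `u(a, c′) = w · ū(a, c′) · w`: an upper unitriangular unitary of matrix `!![1, a, c′; 0, 1, −σa; 0, 0, 1]` is the `w`-conjugate of the lower one of matrix
`!![1, 0, 0; −σa, 1, 0; c′, a, 1]` (`(w g w)ᵢⱼ = g_{rev i, rev j}`). [cite: Rogawski1990, §1.10 p. 9] -/
theorem eq_weylConj_of_coe_eq {u nb' : ↥(unitaryGroupOfForm σ J)} {a c' : K}
    (hu : ((u : GL (Fin 3) K) : Matrix (Fin 3) (Fin 3) K) = !![1, a, c'; 0, 1, -σ a; 0, 0, 1])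
    (hnb' : ((nb' : GL (Fin 3) K) : Matrix (Fin 3) (Fin 3) K) = !![1, 0, 0; -σ a, 1, 0; c', a, 1]) :
    u = weylLongU σ hJ * nb' * weylLongU σ hJ := by
  apply Subtype.ext
  apply Units.ext
  ext i j
  rw [coe_weylLongU_mul_mul_weylLongU_apply', hu, hnb']
  fin_cases i <;> fin_cases j <;> rfl

include hJ hσ hvσ hJg hJgw in
/-- **TRANSPORT OF A CHART-(I) WITNESS TO AN UPPER SHELL (coordinates).**  Let `n̄ = ū(x, z)` (`z + σz + xσx = 0`, `z ≠ 0`) and `ū′ = ū(x∕z, 1∕z)`; let `u″ ∈ N` be a depth witness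
for `ū′` in the SWAPPED group: `j″ := ū′⁻¹ u″ ū′ ∈ J_{e^w}` with `(j″)₀₀ = (1+c)(1+ε)` (★ `K2E3TwoDepthDepthWitness`, families X∕Z, read for `e^w`).  Then `b₀ := w (j″)⁻¹ w` satisfies:
`b₀ ∈ J_e`, `n̄ b₀ n̄⁻¹ ∈ N` (indeed `= p u″⁻¹ p⁻¹` for the `p ∈ B` of ★ p861613's `n̄ = p·w·u(x∕z,1∕z)`), and `(b₀)₀₀ = σ(1+c)·σ(1+ε)` — the engine's `hwit` datum at the representative
`r = n̄` (`θ(b₀) = χ₁((b₀)₀₀)`, `τ = 1` on `N`). [cite: Roche1998, §4] [cite: Casselman1995, Prop. 1.3.1, §6.3] [cite: BruhatTits1972, (4.4.4), (6.4.9)] -/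
theorem exists_upperShell_witness (hsym : ∀ i j, e (Fin.rev j) (Fin.rev i) = e i j)
    {nb nb' u'' : ↥(unitaryGroupOfForm σ J)} {x z c ε : K}
    (hnb : ((nb : GL (Fin 3) K) : Matrix (Fin 3) (Fin 3) K) = !![1, 0, 0; -σ x, 1, 0; z, x, 1]) (hrel : z + σ z + x * σ x = 0) (hz : z ≠ 0)
    (hnb' : ((nb' : GL (Fin 3) K) : Matrix (Fin 3) (Fin 3) K) = !![1, 0, 0; -σ (x / z), 1, 0; z⁻¹, x / z, 1])
    (hu'' : u'' ∈ unipotentU σ J) (hj : nb'⁻¹ * u'' * nb' ∈ Jgw)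
    (h00 : (((nb'⁻¹ * u'' * nb' : ↥(unitaryGroupOfForm σ J)) : GL (Fin 3) K) : Matrix (Fin 3) (Fin 3) K) 0 0 = (1 + c) * (1 + ε)) :
    ∃ b₀ ∈ Jg, nb * b₀ * nb⁻¹ ∈ unipotentU σ J ∧
      ((b₀ : GL (Fin 3) K) : Matrix (Fin 3) (Fin 3) K) 0 0 = σ (1 + c) * σ (1 + ε) := by
  obtain ⟨p, u, hp, -, hu, heq⟩ := K2E3LowerUnipotentBigCellIntegral.exists_borel_mul_weylLongU_mul_upper σ hJ hσ hnb hrel hz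
  have huw : u = weylLongU σ hJ * nb' * weylLongU σ hJ := eq_weylConj_of_coe_eq σ hJ hu hnb'
  have hw : weylLongU σ hJ * weylLongU σ hJ = 1 := weylLongU_mul_weylLongU σ hJ
  refine ⟨weylLongU σ hJ * (nb'⁻¹ * u'' * nb')⁻¹ * weylLongU σ hJ, weylConj_inv_mem_of_mem σ hJ hvσ e Jg Jgw hJg hJgw hsym hj, ?_, ?_⟩
  · -- `n̄ b₀ n̄⁻¹ = p u″⁻¹ p⁻¹ ∈ N`
    have key : nb * (weylLongU σ hJ * (nb'⁻¹ * u'' * nb')⁻¹ * weylLongU σ hJ) * nb⁻¹ = p * u''⁻¹ * p⁻¹ := by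
      have hww : ∀ g : ↥(unitaryGroupOfForm σ J), weylLongU σ hJ * (weylLongU σ hJ * g) = g := fun g => by rw [← mul_assoc, hw, one_mul]
      have hwinv : (weylLongU σ hJ)⁻¹ = weylLongU σ hJ := inv_eq_of_mul_eq_one_right hw
      have hnb2 : nb = p * (nb' * weylLongU σ hJ) := by rw [heq, huw]; simp only [mul_assoc, hww]
      rw [hnb2]
      simp only [_root_.mul_inv_rev, inv_inv, hwinv, mul_assoc, hww, mul_inv_cancel_left]
    rw [key]
    exact conj_mem_unipotentU_of_mem_borelU σ hp (Subgroup.inv_mem _ hu'')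
  · rw [weylConj_inv_apply_zero_zero σ hJ, h00, map_mul]

include hJ hσ hvσ hJg hJgw in
/-- **The same, consuming the witness PACKAGE** `∃ u″, u″ ∈ N ∧ ū′⁻¹ u″ ū′ ∈ J_{e^w} ∧ ∃ ε, |ε| ≤ |ϖ|^{m+1} ∧ (ū′⁻¹ u″ ū′)₀₀ = (1+c)(1+ε)` — the conclusion shape of ★
`K2E3TwoDepthDepthWitness.exists_familyX_witness_twoDepth` ∕ `exists_familyZ_witness_twoDepth` (K2E3-p37 (g2)) stated for the swapped test — and returning the engine's datum
with the error bound carried along (`|σε| = |ε|`). [cite: Roche1998, §4] [cite: Casselman1995, §6.3] [cite: BruhatTits1972, (6.4.9)] -/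
theorem exists_upperShell_witness_of_exists (hsym : ∀ i j, e (Fin.rev j) (Fin.rev i) = e i j)
    {nb nb' : ↥(unitaryGroupOfForm σ J)} {x z c : K} {m : ℕ}
    (hnb : ((nb : GL (Fin 3) K) : Matrix (Fin 3) (Fin 3) K) = !![1, 0, 0; -σ x, 1, 0; z, x, 1]) (hrel : z + σ z + x * σ x = 0) (hz : z ≠ 0)
    (hnb' : ((nb' : GL (Fin 3) K) : Matrix (Fin 3) (Fin 3) K) = !![1, 0, 0; -σ (x / z), 1, 0; z⁻¹, x / z, 1])
    (hwit : ∃ u'' : ↥(unitaryGroupOfForm σ J), u'' ∈ unipotentU σ J ∧ nb'⁻¹ * u'' * nb' ∈ Jgw ∧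
      ∃ ε : K, Valued.v ε ≤ Valued.v ϖ ^ (m + 1) ∧
        (((nb'⁻¹ * u'' * nb' : ↥(unitaryGroupOfForm σ J)) : GL (Fin 3) K) : Matrix (Fin 3) (Fin 3) K) 0 0 = (1 + c) * (1 + ε)) :
    ∃ b₀ ∈ Jg, nb * b₀ * nb⁻¹ ∈ unipotentU σ J ∧
      ∃ ε' : K, Valued.v ε' ≤ Valued.v ϖ ^ (m + 1) ∧ ((b₀ : GL (Fin 3) K) : Matrix (Fin 3) (Fin 3) K) 0 0 = σ (1 + c) * (1 + ε') := by
  obtain ⟨u'', hu'', hj, ε, hε, h00⟩ := hwit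
  obtain ⟨b₀, hb₀, hN, hb00⟩ := exists_upperShell_witness σ hJ hσ hvσ e Jg Jgw hJg hJgw hsym hnb hrel hz hnb' hu'' hj h00
  refine ⟨b₀, hb₀, hN, σ ε, by rw [hvσ]; exact hε, ?_⟩
  rw [hb00, map_add, map_one, map_add, map_one]

end Summit.HodgeConjecture.HodgeConjecture.Cruxes.H413.K2E3TwoDepthUpperShellTransport

end
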